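import Mathlib
import HarnessLib

/-!
# Route OverlapGapAlgebra, crux `NoStableSection` (stmt-PneNP-2462), line `DartGame`: definitions

Objects posited by the line `DartGame` (lead prover-line-stmt-PneNP-2462-0, 2026-08-16) for the
crux `Summit.PneNP.PneNP.Theses.OverlapGapAlgebra.NoStableSection` — Bresler–Huang's ensemble
multi-OGP for random `k`-SAT (arXiv:2106.02129, §4–5) read for an ARBITRARY section `g`, in pure
counting form over the crux's typed path space. The skeleton
`Summits/PneNP/PneNP/Cruxes/NoStableSection/Lines/DartGame.lean` and its stub files
`Theorems/OverlapGapAlgebraNoStableSection*.lean` are stated in exactly this vocabulary: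
* the path: `Inst m k n` (verbatim the crux's `Fin m → Fin k → Fin n × Bool`), `PathSp k m n`
  (`k+1` i.i.d. arrays), `splice` (verbatim the crux's `let P`), `instAt` (the same instance indexed
  by the linear time `t = r·(m k) + q ∈ [0, k·(m k)]`, BH Def. 4.2), `violCount`;
* the entropy functional of the ladder argument, on sequences of assignments `Y : ℕ → Fin n → Bool`
  (only finitely many rungs are ever read): `patCount Y ℓ ξ` (positions whose column over rungs
  `0..ℓ-1` is `ξ`), `typeEnt Y ℓ = Σ_ξ η(patCount/n)` (empirical entropy of the first `ℓ` rungs,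
  nats), `condEnt Y ℓ = typeEnt Y (ℓ+1) - typeEnt Y ℓ` (conditional entropy of rung `ℓ` given
  rungs `< ℓ`: the ORDERED form of BH's conditional overlap entropy, Def. 4.3 / Fact 4.5), `withRung`
  (insert a candidate as rung `ℓ`), `seqOf` (a finite tuple as a sequence);
* the energy functional `energySum Y k = Σ_{I : Fin k → Fin n} #{(Y ℓ ∘ I) : ℓ ≤ k}` (BH §5.1);
* the three events of the decomposition `StableValid ⊆ IndepBad ∪ OgpBad` (BH Prop. 4.6):
  `StableValid` (the crux's event), `IndepBad` (complement of BH's `S_indep`, §4.4, with "at least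
  one sweep after every earlier rung"), `OgpBad` (complement of `S_ogp`).
Bookkeeping proved here: `splice_zero/full/succ_of_ne`, `instAt_eq_splice`, `sum_patCount`,
`patCount_succ_eq`, the CONDITIONAL FORM `condEnt_eq_sum_binEntropy`
(`condEnt Y ℓ = Σ_ξ (N_ξ/n) · h₂(N_{ξ1}/N_ξ)`), `condEnt_nonneg`, locality (`*_congr`).
Sources: Bresler–Huang, FOCS 2021 / arXiv:2106.02129 §4–5; Cover–Thomas Thm 11.1.3 (types).
-/

namespace Summit.PneNP.PneNP.Cruxes.NoStableSection.DartGame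

set_option linter.dupNamespace false -- `Summit.PneNP.PneNP.…`: summit = sub-problem (D-0017)

open Finset Real

/-! ## The typed path space -/

section Path

variable {k m n : ℕ}

/-- An instance: `m` clauses, each a `k`-tuple of literals `(variable, sign)`; literal `(v, b)` is
true under `σ` iff `σ v = b` (verbatim the crux's `Fin m → Fin k → Fin n × Bool`). -/
abbrev Inst (m k n : ℕ) : Type := Fin m → Fin k → Fin n × Bool

/-- The path space: `k + 1` independent uniform literal arrays `Ψ₀, …, Ψ_k` (the crux's `Ψ`). -/
abbrev PathSp (k m n : ℕ) : Type := Fin (k + 1) → Inst m k n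

/-- The instance at splice point `(r, q)`: literal position `a·k + b` is read from `Ψ (r+1)` if
`a·k + b < q` and from `Ψ r` otherwise (verbatim the `let P` of the crux; BH Def. 4.2). -/
def splice (Ψ : PathSp k m n) (r : Fin k) (q : ℕ) : Inst m k n :=
  fun a b => if (a : ℕ) * k + b < q then Ψ r.succ a b else Ψ r.castSucc a b

/-- At offset `q = 0` the instance of sweep `r` is `Ψ r`. -/
theorem splice_zero (Ψ : PathSp k m n) (r : Fin k) : splice Ψ r 0 = Ψ r.castSucc := by
  funext a b
  simp [splice]

/-- At offset `q = m * k` the instance of sweep `r` is `Ψ (r+1)` (the path is connected). -/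
theorem splice_full (Ψ : PathSp k m n) (r : Fin k) : splice Ψ r (m * k) = Ψ r.succ := by
  funext a b
  have ha := a.isLt
  have hb := b.isLt
  have h : (a : ℕ) * k + b < m * k := by
    calc (a : ℕ) * k + b < (a : ℕ) * k + k := by omega
      _ = ((a : ℕ) + 1) * k := by ring
      _ ≤ m * k := Nat.mul_le_mul_right k ha
  simp [splice, h]

/-- One splice step changes at most the literal at position `q`. -/
theorem splice_succ_of_ne (Ψ : PathSp k m n) (r : Fin k) (q : ℕ) (a : Fin m) (b : Fin k)
    (h : (a : ℕ) * k + b ≠ q) : splice Ψ r (q + 1) a b = splice Ψ r q a b := by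
  unfold splice
  by_cases h1 : (a : ℕ) * k + b < q
  · have h2 : (a : ℕ) * k + b < q + 1 := by omega
    simp [h1, h2]
  · have h2 : ¬ (a : ℕ) * k + b < q + 1 := by omega
    simp [h1, h2]

/-- The instance at linear time `t ∈ [0, k·(m k)]`: `t = r·(m k) + q` with `q < m k` is splice point
`(r, q)`, and the endpoint `t = k·(m k)` (and, as a junk value, every later `t`) is `Ψ k`. -/
def instAt (Ψ : PathSp k m n) (t : ℕ) : Inst m k n :=
  if h : t < k * (m * k) then
    splice Ψ ⟨t / (m * k), Nat.div_lt_of_lt_mul ((Nat.mul_comm k (m * k)) ▸ h)⟩ (t % (m * k))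
  else Ψ (Fin.last k)

/-- Unfolding `instAt` below the endpoint. -/
theorem instAt_of_lt (Ψ : PathSp k m n) {t : ℕ} (ht : t < k * (m * k)) (r : Fin k) (q : ℕ)
    (hr : t / (m * k) = r) (hq : t % (m * k) = q) : instAt Ψ t = splice Ψ r q := by
  unfold instAt
  rw [dif_pos ht]
  congr 1
  exact Fin.ext hr

/-- Unfolding `instAt` at (and beyond) the endpoint. -/
theorem instAt_of_le (Ψ : PathSp k m n) {t : ℕ} (ht : k * (m * k) ≤ t) :
    instAt Ψ t = Ψ (Fin.last k) := by
  unfold instAt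
  rw [dif_neg (Nat.not_lt.2 ht)]

/-- `instAt` at time `r·(m k) + q`, `q ≤ m k`, is the splice point `(r, q)` (at `q = m k` this is
the connectedness of the path across sweeps). -/
theorem instAt_eq_splice (Ψ : PathSp k m n) (r : Fin k) {q : ℕ} (hq : q ≤ m * k) :
    instAt Ψ ((r : ℕ) * (m * k) + q) = splice Ψ r q := by
  have hr := r.isLt
  -- degenerate case `m = 0`: instances form a subsingleton
  rcases Nat.eq_zero_or_pos m with rfl | hm
  · funext a; exact a.elim0
  have hW : 0 < m * k := Nat.mul_pos hm (by omega)
  rcases lt_or_eq_of_le hq with hlt | rfl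
  · have ht : (r : ℕ) * (m * k) + q < k * (m * k) := by
      calc (r : ℕ) * (m * k) + q < (r : ℕ) * (m * k) + m * k := by omega
        _ = ((r : ℕ) + 1) * (m * k) := by ring
        _ ≤ k * (m * k) := Nat.mul_le_mul_right _ hr
    refine instAt_of_lt Ψ ht r q ?_ ?_
    · rw [Nat.mul_comm, Nat.mul_add_div hW, Nat.div_eq_of_lt hlt, Nat.add_zero]
    · rw [Nat.mul_comm, Nat.mul_add_mod, Nat.mod_eq_of_lt hlt]
  · -- `q = m * k`: the endpoint of sweep `r` is `Ψ (r+1)`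
    rw [splice_full]
    by_cases hlast : (r : ℕ) + 1 < k
    · have ht : (r : ℕ) * (m * k) + m * k < k * (m * k) := by
        calc (r : ℕ) * (m * k) + m * k = ((r : ℕ) + 1) * (m * k) := by ring
          _ < k * (m * k) := Nat.mul_lt_mul_of_pos_right hlast hW
      rw [instAt_of_lt Ψ ht ⟨r + 1, hlast⟩ 0, splice_zero]
      · rfl
      · rw [show (r : ℕ) * (m * k) + m * k = ((r : ℕ) + 1) * (m * k) by ring,
          Nat.mul_div_cancel _ hW]
      · rw [show (r : ℕ) * (m * k) + m * k = ((r : ℕ) + 1) * (m * k) by ring, Nat.mul_mod_left]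
    · have hrk : (r : ℕ) + 1 = k := by omega
      rw [instAt_of_le Ψ (by
        rw [show (r : ℕ) * (m * k) + m * k = ((r : ℕ) + 1) * (m * k) by ring, hrk])]
      congr 1
      exact Fin.ext (by simp [hrk])

/-- Number of clauses of `Φ` violated by the assignment `σ` (a clause is violated iff all its
literals are false, literal `(v, b)` being true iff `σ v = b`). -/
def violCount (σ : Fin n → Bool) (Φ : Inst m k n) : ℕ :=
  (univ.filter fun i : Fin m => ∀ j, σ (Φ i j).1 ≠ (Φ i j).2).card

end Path

/-! ## Empirical (type) entropies of a sequence of assignments -/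

section Entropy

variable {n : ℕ}

/-- Number of positions `i` whose column over the first `ℓ` rungs is the pattern `ξ`. -/
def patCount (Y : ℕ → Fin n → Bool) (ℓ : ℕ) (ξ : Fin ℓ → Bool) : ℕ :=
  (univ.filter fun i : Fin n => (fun j : Fin ℓ => Y j i) = ξ).card

/-- Empirical entropy (nats) of the column patterns of the first `ℓ` rungs:
`H_ℓ(Y) = Σ_ξ η(N_ℓ(ξ)/n)`, `η = Real.negMulLog`. -/
noncomputable def typeEnt (Y : ℕ → Fin n → Bool) (ℓ : ℕ) : ℝ :=
  ∑ ξ : Fin ℓ → Bool, negMulLog ((patCount Y ℓ ξ : ℝ) / n)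

/-- Conditional (type) entropy of rung `ℓ` given rungs `0, …, ℓ-1`: `H_{ℓ+1} - H_ℓ`. -/
noncomputable def condEnt (Y : ℕ → Fin n → Bool) (ℓ : ℕ) : ℝ :=
  typeEnt Y (ℓ + 1) - typeEnt Y ℓ

/-- The sequence `R` with the candidate `v` inserted as rung `ℓ` (and all later rungs). -/
def withRung (R : ℕ → Fin n → Bool) (ℓ : ℕ) (v : Fin n → Bool) : ℕ → Fin n → Bool :=
  fun j => if j < ℓ then R j else v

/-- A finite tuple of assignments as a sequence (junk value `false` beyond its length). -/
def seqOf {L : ℕ} (Y : Fin L → Fin n → Bool) : ℕ → Fin n → Bool :=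
  fun j => if h : j < L then Y ⟨j, h⟩ else fun _ => false

/-- `seqOf` below the length. -/
theorem seqOf_apply_lt {L : ℕ} (Y : Fin L → Fin n → Bool) {j : ℕ} (h : j < L) :
    seqOf Y j = Y ⟨j, h⟩ := by
  simp [seqOf, h]

/-- `seqOf` at an index of the tuple. -/
@[simp] theorem seqOf_apply_fin {L : ℕ} (Y : Fin L → Fin n → Bool) (j : Fin L) :
    seqOf Y j = Y j := by
  simp [seqOf, j.isLt]

/-- `withRung` below the insertion point reads the prefix. -/
theorem withRung_of_lt (R : ℕ → Fin n → Bool) (ℓ : ℕ) (v : Fin n → Bool) {j : ℕ} (h : j < ℓ) :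
    withRung R ℓ v j = R j := by
  simp [withRung, h]

/-- `withRung` at and beyond the insertion point reads the candidate. -/
theorem withRung_of_le (R : ℕ → Fin n → Bool) (ℓ : ℕ) (v : Fin n → Bool) {j : ℕ} (h : ℓ ≤ j) :
    withRung R ℓ v j = v := by
  simp [withRung, Nat.not_lt.2 h]

/-- `withRung` at the insertion point is the candidate. -/
@[simp] theorem withRung_self (R : ℕ → Fin n → Bool) (ℓ : ℕ) (v : Fin n → Bool) :
    withRung R ℓ v ℓ = v :=
  withRung_of_le R ℓ v le_rfl

/-- `withRung R ℓ v` only reads `R` below `ℓ`. -/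
theorem withRung_congr {R R' : ℕ → Fin n → Bool} {ℓ : ℕ} (h : ∀ j < ℓ, R j = R' j)
    (v : Fin n → Bool) : withRung R ℓ v = withRung R' ℓ v := by
  funext j
  by_cases hj : j < ℓ
  · simp [withRung, hj, h j hj]
  · simp [withRung, hj]

/-- `patCount Y ℓ` only reads rungs `< ℓ`. -/
theorem patCount_congr {Y Y' : ℕ → Fin n → Bool} {ℓ : ℕ} (h : ∀ j < ℓ, Y j = Y' j)
    (ξ : Fin ℓ → Bool) : patCount Y ℓ ξ = patCount Y' ℓ ξ := by
  unfold patCount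
  congr 1
  ext i
  simp only [mem_filter, mem_univ, true_and]
  have : (fun j : Fin ℓ => Y j i) = fun j : Fin ℓ => Y' j i := by
    funext j; rw [h j j.isLt]
  rw [this]

/-- `typeEnt Y ℓ` only reads rungs `< ℓ`. -/
theorem typeEnt_congr {Y Y' : ℕ → Fin n → Bool} {ℓ : ℕ} (h : ∀ j < ℓ, Y j = Y' j) :
    typeEnt Y ℓ = typeEnt Y' ℓ := by
  unfold typeEnt
  exact sum_congr rfl fun ξ _ => by rw [patCount_congr h]

/-- `condEnt Y ℓ` only reads rungs `≤ ℓ`. -/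
theorem condEnt_congr {Y Y' : ℕ → Fin n → Bool} {ℓ : ℕ} (h : ∀ j ≤ ℓ, Y j = Y' j) :
    condEnt Y ℓ = condEnt Y' ℓ := by
  unfold condEnt
  rw [typeEnt_congr (fun j hj => h j (by omega)), typeEnt_congr (fun j hj => h j (by omega))]

/-- The potential of the ladder argument is local in the prefix. -/
theorem condEnt_withRung_congr {R R' : ℕ → Fin n → Bool} {ℓ : ℕ} (h : ∀ j < ℓ, R j = R' j)
    (v : Fin n → Bool) : condEnt (withRung R ℓ v) ℓ = condEnt (withRung R' ℓ v) ℓ := by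
  rw [withRung_congr h]

/-- The pattern classes partition the positions: `Σ_ξ N_ℓ(ξ) = n`. -/
theorem sum_patCount (Y : ℕ → Fin n → Bool) (ℓ : ℕ) : ∑ ξ : Fin ℓ → Bool, patCount Y ℓ ξ = n := by
  unfold patCount
  rw [← card_eq_sum_card_fiberwise (f := fun i : Fin n => fun j : Fin ℓ => Y j i) (s := univ)
    (t := univ) (fun _ _ => mem_univ _)]
  simp

/-- Refining a pattern class by the value of rung `ℓ`: `N_ℓ(ξ) = N_{ℓ+1}(ξ·true) + N_{ℓ+1}(ξ·false)`
(patterns of length `ℓ+1` written as `Fin.snoc ξ b`). -/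
theorem patCount_succ_eq (Y : ℕ → Fin n → Bool) (ℓ : ℕ) (ξ : Fin ℓ → Bool) :
    patCount Y ℓ ξ = patCount Y (ℓ + 1) (Fin.snoc ξ true) + patCount Y (ℓ + 1) (Fin.snoc ξ false) := by
  unfold patCount
  rw [← card_union_of_disjoint]
  · congr 1
    ext i
    simp only [mem_filter, mem_univ, true_and, mem_union]
    constructor
    · intro h
      cases hb : Y ℓ i
      · right
        funext j
        refine Fin.lastCases ?_ (fun j => ?_) j
        · simp [hb]
        · simpa using congrFun h j
      · left
        funext j
        refine Fin.lastCases ?_ (fun j => ?_) j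
        · simp [hb]
        · simpa using congrFun h j
    · rintro (h | h)
      · funext j
        have := congrFun h (Fin.castSucc j)
        simpa using this
      · funext j
        have := congrFun h (Fin.castSucc j)
        simpa using this
  · rw [disjoint_filter]
    intro i _ h1 h2
    have h1' := congrFun h1 (Fin.last ℓ)
    have h2' := congrFun h2 (Fin.last ℓ)
    simp only [Fin.snoc_last] at h1' h2'
    rw [h1'] at h2'
    exact Bool.noConfusion h2'

/-- Every position carries the empty pattern: `N_0(ξ) = n`. -/
theorem patCount_zero (Y : ℕ → Fin n → Bool) (ξ : Fin 0 → Bool) : patCount Y 0 ξ = n := by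
  unfold patCount
  rw [filter_true_of_mem (fun i _ => Subsingleton.elim _ _)]
  simp

/-- `H_0 = 0` (one empty pattern, carried by all `n` positions). -/
theorem typeEnt_zero (Y : ℕ → Fin n → Bool) : typeEnt Y 0 = 0 := by
  unfold typeEnt
  simp only [patCount_zero]
  rcases Nat.eq_zero_or_pos n with rfl | hn
  · simp [negMulLog]
  · rw [div_self (by exact_mod_cast hn.ne')]
    simp [negMulLog]

/-- The sum over patterns of length `ℓ + 1` as a sum over (pattern of length `ℓ`, last bit). -/
theorem sum_pattern_succ {M : Type*} [AddCommMonoid M] (ℓ : ℕ) (f : (Fin (ℓ + 1) → Bool) → M) :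
    ∑ ξ' : Fin (ℓ + 1) → Bool, f ξ' =
      ∑ ξ : Fin ℓ → Bool, (f (Fin.snoc ξ true) + f (Fin.snoc ξ false)) := by
  rw [← (Fin.snocEquiv fun _ : Fin (ℓ + 1) => Bool).sum_comp, Fintype.sum_prod_type,
    Fintype.sum_bool, ← sum_add_distrib]
  rfl

/-- **Conditional form** of the conditional type entropy (BH Fact 4.5, chain rule, read backwards):
`condEnt Y ℓ = Σ_ξ (N_ℓ(ξ)/n) · h₂(N_{ℓ+1}(ξ·true)/N_ℓ(ξ))` with `h₂ = Real.binEntropy` (a class with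
`N_ℓ(ξ) = 0` contributes `0`). -/
theorem condEnt_eq_sum_binEntropy (Y : ℕ → Fin n → Bool) (ℓ : ℕ) :
    condEnt Y ℓ = ∑ ξ : Fin ℓ → Bool, ((patCount Y ℓ ξ : ℝ) / n) *
      binEntropy ((patCount Y (ℓ + 1) (Fin.snoc ξ true) : ℝ) / patCount Y ℓ ξ) := by
  unfold condEnt typeEnt
  rw [sum_pattern_succ, ← sum_sub_distrib]
  refine sum_congr rfl fun ξ _ => ?_
  -- abbreviations: `N = A + B`
  have hN := patCount_succ_eq Y ℓ ξ
  set N : ℕ := patCount Y ℓ ξ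
  set A : ℕ := patCount Y (ℓ + 1) (Fin.snoc ξ true)
  set B : ℕ := patCount Y (ℓ + 1) (Fin.snoc ξ false)
  rcases Nat.eq_zero_or_pos N with hN0 | hNpos
  · have hA : A = 0 := by omega
    have hB : B = 0 := by omega
    simp [hN0, hA, hB, negMulLog]
  · have hNr : (0 : ℝ) < N := by exact_mod_cast hNpos
    set lam : ℝ := (A : ℝ) / N with hlam
    have hA' : (A : ℝ) / n = lam * ((N : ℝ) / n) := by
      rw [hlam]; field_simp
    have hB' : (B : ℝ) / n = (1 - lam) * ((N : ℝ) / n) := by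
      have : (B : ℝ) = N - A := by
        have : (N : ℝ) = A + B := by exact_mod_cast hN
        linarith
      rw [this, hlam]
      field_simp
    rw [hA', hB', negMulLog_mul, negMulLog_mul, binEntropy_eq_negMulLog_add_negMulLog_one_sub]
    ring

/-- Conditional type entropies are nonnegative. -/
theorem condEnt_nonneg (Y : ℕ → Fin n → Bool) (ℓ : ℕ) : 0 ≤ condEnt Y ℓ := by
  rw [condEnt_eq_sum_binEntropy]
  refine sum_nonneg fun ξ _ => mul_nonneg (by positivity) (binEntropy_nonneg (by positivity) ?_)
  rcases Nat.eq_zero_or_pos (patCount Y ℓ ξ) with h0 | hpos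
  · simp [h0]
  · rw [div_le_one (by exact_mod_cast hpos)]
    exact_mod_cast (by rw [patCount_succ_eq Y ℓ ξ]; omega :
      patCount Y (ℓ + 1) (Fin.snoc ξ true) ≤ patCount Y ℓ ξ)

end Entropy

/-! ## The energy functional -/

section Energy

variable {n : ℕ}

/-- The set of patterns `{(Y ℓ ∘ I) : ℓ ≤ k}` read by the variable tuple `I`. -/
def patternsAt (Y : ℕ → Fin n → Bool) (k : ℕ) (I : Fin k → Fin n) : Finset (Fin k → Bool) :=
  univ.image fun ℓ : Fin (k + 1) => fun r => Y ℓ (I r)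

/-- `energySum Y k = Σ_{I : Fin k → Fin n} |{(Y ℓ ∘ I) : ℓ ≤ k}|`, i.e. `n^k · E_I |{y^ℓ[I] : ℓ ≤ k}|`
(the energy term of BH Lemma 5.1 / Prop. 5.2 before normalisation). -/
def energySum (Y : ℕ → Fin n → Bool) (k : ℕ) : ℕ :=
  ∑ I : Fin k → Fin n, (patternsAt Y k I).card

end Energy

/-! ## The three events -/

section Events

variable {k m n : ℕ}

/-- The crux's event for the section `g`: `ν`-valid at every splice point and `η n`-stable between
consecutive ones (syntactically the filter predicate of `NoStableSection` with `P = splice Ψ`). -/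
def StableValid (g : Inst m k n → (Fin n → Bool)) (η ν : ℝ) (Ψ : PathSp k m n) : Prop :=
  (∀ r : Fin k, ∀ q ≤ m * k,
      ((univ.filter fun i : Fin m => ∀ j, g (splice Ψ r q) (splice Ψ r q i j).1 ≠
        (splice Ψ r q i j).2).card : ℝ) ≤ ν * m) ∧
    ∀ r : Fin k, ∀ q < m * k, (hammingDist (g (splice Ψ r q)) (g (splice Ψ r (q + 1))) : ℝ) ≤ η * n

/-- Complement of BH's `S_indep` for the section `g` (slightly enlarged): some instance at a time
`t₀ ≤ k·(m k)` has a `ν`-valid assignment `y` of conditional type entropy `≤ bp` relative to the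
outputs of `g` at `ℓ ≤ k` earlier times, each at least one full sweep (`m k` steps) before `t₀`. -/
def IndepBad (g : Inst m k n → (Fin n → Bool)) (ν bp : ℝ) (Ψ : PathSp k m n) : Prop :=
  ∃ ℓ : Fin (k + 1), ∃ t₀ : ℕ, ∃ ts : Fin ℓ → ℕ, ∃ y : Fin n → Bool,
    t₀ ≤ k * (m * k) ∧ (∀ j, ts j + m * k ≤ t₀) ∧
    (violCount y (instAt Ψ t₀) : ℝ) ≤ ν * m ∧
    condEnt (withRung (seqOf fun j : Fin ℓ => g (instAt Ψ (ts j))) ℓ y) ℓ ≤ bp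

/-- Complement of BH's `S_ogp` (the forbidden ladder): times `t₀ ≤ … ≤ t_k ≤ k·(m k)` and assignments
`y⁰, …, y^k`, each `ν`-valid for the instance at its time, every rung `ℓ ≥ 1` of conditional type
entropy in `[bm, bp]` given its predecessors. -/
def OgpBad (k m n : ℕ) (ν bm bp : ℝ) (Ψ : PathSp k m n) : Prop :=
  ∃ ts : Fin (k + 1) → ℕ, ∃ Y : Fin (k + 1) → (Fin n → Bool),
    Monotone ts ∧ ts (Fin.last k) ≤ k * (m * k) ∧
    (∀ ℓ, (violCount (Y ℓ) (instAt Ψ (ts ℓ)) : ℝ) ≤ ν * m) ∧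
    ∀ ℓ : Fin (k + 1), 1 ≤ (ℓ : ℕ) → condEnt (seqOf Y) ℓ ∈ Set.Icc bm bp

end Events

end Summit.PneNP.PneNP.Cruxes.NoStableSection.DartGame
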